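import Mathlib
import HarnessLib
import Summits.HubbardSuperconductivity.HubbardSuperconductivity.Theorems.KLProgrammeKLRegimeVolumeLimitHartree

/-!
# Child 5 `KLRegimeVolumeLimitV7` (stmt-HubbardSuperconductivity-19665) — the ORDER-`U¹` RUNG satisfies the volume-limit text:
# uniform bound and per-Matsubara-integer grid convergence of `d/dU|₀ klSelfEnergy … (nScales β + 1)` (seat hubbard-kl-k3c5-p2)

By `…VolumeLimitHartree`, `S₁(L,M;k,σ) := d/dU|₀ Σ̂^K_{L,M}(k,σ;U) = −(ĝ₀(k)/ĝ_K(k))² · A_{L,M}` with the truncated tadpole average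
`A_{L,M} = (βL²)⁻¹ Σ_q ĝ₀(q)`.  (i) `|A_{L,M}| ≤ ½` uniformly in the volume: the symmetric Matsubara sum is real, `Σ_ω 1/(−iω+ξ) =
ξ Σ_ω 1/(ω² + ξ²) ≤ ξ · β tanh(βξ/2)/(2ξ)` (the tree's `tsum_one_div_matsubara_sq_add_sq`), and the dressing `ĝ₀/ĝ_K = 1 − K(p)ĝ₀` is bounded by
`1 + ‖K‖₀ β/π`; (ii) `A_{L,M}` is `−reprFree` of child 4 at the bare frame and coincident points, whose iterated limit `M → ∞` then `L → ∞`
is r2d-p2's `stub_asm_free`; the dressing is an explicit continuous function of `(ω_n, p)` read EXACTLY on the grid.  Hence the three clauses of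
`FinalTwoLegVolLimit`, verbatim, for the first `U`-derivative of the carrier (`firstOrder_volLimit`): the order-`U¹` rung of child 5 is
WITNESS-PRESENT (plan g10 2026-08-26T16:19:44Z (2)/(3)).  Everything is proved; no definition.
-/

noncomputable section

namespace Summit.HubbardSuperconductivity.HubbardSuperconductivity.Theorems.TwoPointAssembly

set_option linter.dupNamespace false -- summit = problem name (single-conjunct summit), D-0017

open Finset Filter Topology Literature.MathematicalPhysics.QuantumLattice Literature.Probability.LatticeModels GrassmannAlgebra
open Literature.Analysis.SpecialFunctions
open Summit.HubbardSuperconductivity.HubbardSuperconductivity.Theorems.KLRegimeSplit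
open Summit.HubbardSuperconductivity.HubbardSuperconductivity.Theorems.KLProgrammeLegKernels

variable {L M : ℕ} [NeZero L]

/-! ## §1 The truncated tadpole is bounded by `½` uniformly in the volume -/

omit [NeZero L] in
/-- **The symmetric Matsubara sum of the bare propagator is bounded by `β/2`**: `‖Σ_ω 1/(−iω + ξ)‖ ≤ β/2` for every `M` and `ξ` (`β > 0`). -/
theorem norm_sum_propCT_zero_le {β : ℝ} (hβ : 0 < β) (μ : ℝ) (q : TorusSite 2 L) :
    ‖∑ ω : MatsubaraIdx M, propCT L M β μ 0 (ω, q)‖ ≤ β / 2 := by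
  set ξ : ℝ := nambuXiCT L μ 0 q with hξ
  -- the sum is real: `ξ Σ 1/(ω² + ξ²)`
  have hreal : ∑ ω : MatsubaraIdx M, propCT L M β μ 0 (ω, q) =
      ((ξ * ∑ i : MatsubaraIdx M, 1 / (matsubaraFreq β M i ^ 2 + ξ ^ 2) : ℝ) : ℂ) := by
    have h := sum_inv_I_mul_matsubaraFreq_sub β M ξ
    have hterm : ∀ ω : MatsubaraIdx M, propCT L M β μ 0 (ω, q) =
        -((1 : ℂ) / (Complex.I * (matsubaraFreq β M ω : ℂ) - ξ)) := by
      intro ω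
      rw [propCT, hξ]
      rw [show -Complex.I * (matsubaraFreq β M ω : ℂ) + (nambuXiCT L μ 0 q : ℂ) =
        -(Complex.I * (matsubaraFreq β M ω : ℂ) - (nambuXiCT L μ 0 q : ℂ)) by ring, one_div, one_div, inv_neg]
    rw [Finset.sum_congr rfl fun ω _ => hterm ω, Finset.sum_neg_distrib, h]
    push_cast
    rw [Finset.mul_sum, ← Finset.sum_neg_distrib]
    refine Finset.sum_congr rfl fun i _ => ?_
    ring
  rw [hreal, Complex.norm_real, Real.norm_eq_abs]
  have hS_nonneg : 0 ≤ ∑ i : MatsubaraIdx M, 1 / (matsubaraFreq β M i ^ 2 + ξ ^ 2) :=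
    Finset.sum_nonneg fun i _ => by positivity
  by_cases hξ0 : ξ = 0
  · rw [hξ0, zero_mul, abs_zero]; positivity
  -- `Σ_i 1/(ω_i² + ξ²) ≤ β tanh(βξ/2)/(2ξ)`
  have hsum : ∑ i : MatsubaraIdx M, 1 / (matsubaraFreq β M i ^ 2 + ξ ^ 2) ≤ β * Real.tanh (β * ξ / 2) / (2 * ξ) := by
    rw [sum_matsubaraIdx_one_div_sq_add_sq]
    have hle := (summable_one_div_matsubara_sq_add_sq hβ ξ).sum_le_tsum (Finset.range M) (fun n _ => by positivity)
    rw [tsum_one_div_matsubara_sq_add_sq hβ hξ0] at hle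
    have : (2 : ℝ) * (β * Real.tanh (β * ξ / 2) / (4 * ξ)) = β * Real.tanh (β * ξ / 2) / (2 * ξ) := by
      field_simp
      ring
    rw [← this]
    exact mul_le_mul_of_nonneg_left hle (by norm_num)
  rw [abs_mul, abs_of_nonneg hS_nonneg]
  calc |ξ| * ∑ i : MatsubaraIdx M, 1 / (matsubaraFreq β M i ^ 2 + ξ ^ 2)
      ≤ |ξ| * (β * Real.tanh (β * ξ / 2) / (2 * ξ)) := mul_le_mul_of_nonneg_left hsum (abs_nonneg _)
    _ ≤ β / 2 := by
      rcases lt_or_gt_of_ne hξ0 with h | h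
      · rw [abs_of_neg h]
        have ht := Real.neg_one_lt_tanh (β * ξ / 2)
        have : -ξ * (β * Real.tanh (β * ξ / 2) / (2 * ξ)) = β / 2 * (-Real.tanh (β * ξ / 2)) := by
          field_simp
        rw [this]
        nlinarith
      · rw [abs_of_pos h]
        have ht := Real.tanh_lt_one (β * ξ / 2)
        have : ξ * (β * Real.tanh (β * ξ / 2) / (2 * ξ)) = β / 2 * Real.tanh (β * ξ / 2) := by
          field_simp
        rw [this]
        nlinarith

/-- **The truncated tadpole average is bounded by `½`**: `‖(βL²)⁻¹ Σ_q ĝ₀(q)‖ ≤ ½` for every `(L, M)` (`β > 0`). -/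
theorem norm_tadpoleAvg_le {β : ℝ} (hβ : 0 < β) (μ : ℝ) :
    ‖(∑ q : FreqMomentum L M, propCT L M β μ 0 q) / ((β * (L : ℝ) ^ 2 : ℝ) : ℂ)‖ ≤ 1 / 2 := by
  have hL : (0 : ℝ) < (L : ℝ) := by exact_mod_cast Nat.pos_of_ne_zero (NeZero.ne L)
  have hc : (0 : ℝ) < β * (L : ℝ) ^ 2 := by positivity
  rw [norm_div, Complex.norm_real, Real.norm_eq_abs, abs_of_pos hc, div_le_iff₀ hc]
  -- `Σ_q = Σ_{q⃗} Σ_ω`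
  have hsplit : ∑ q : FreqMomentum L M, propCT L M β μ 0 q =
      ∑ qv : TorusSite 2 L, ∑ ω : MatsubaraIdx M, propCT L M β μ 0 (ω, qv) := by
    rw [Fintype.sum_prod_type, Finset.sum_comm]
  rw [hsplit]
  calc ‖∑ qv : TorusSite 2 L, ∑ ω : MatsubaraIdx M, propCT L M β μ 0 (ω, qv)‖
      ≤ ∑ qv : TorusSite 2 L, ‖∑ ω : MatsubaraIdx M, propCT L M β μ 0 (ω, qv)‖ := norm_sum_le _ _
    _ ≤ ∑ _qv : TorusSite 2 L, β / 2 := Finset.sum_le_sum fun qv _ => norm_sum_propCT_zero_le hβ μ qv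
    _ = 1 / 2 * (β * (L : ℝ) ^ 2) := by
      rw [Finset.sum_const, Finset.card_univ, card_torusSite, nsmul_eq_mul]
      push_cast
      ring

/-! ## §2 The frame dressing is bounded and continuous -/

omit [NeZero L] in
/-- `‖(−iω + e_K)/(−iω + ξ)‖ ≤ 1 + ‖K‖₀ β/π` for `|ω| ≥ π/β` (`ξ − e_K = K(p)`). -/
theorem norm_dressing_le {β : ℝ} (hβ : 0 < β) (μ : ℝ) (K : TrigPolyC4v) (ω : ℝ) (hω : Real.pi / β ≤ |ω|) (p : Fin 2 → ℝ) :
    ‖(-Complex.I * (ω : ℂ) + ((-2 * ∑ i, Real.cos (p i) - μ - K.eval p : ℝ) : ℂ)) /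
        (-Complex.I * (ω : ℂ) + ((-2 * ∑ i, Real.cos (p i) - μ : ℝ) : ℂ))‖ ≤
      1 + K.coeffNorm 0 * (β / Real.pi) := by
  have hπβ : 0 < Real.pi / β := div_pos Real.pi_pos hβ
  have hω0 : 0 < |ω| := lt_of_lt_of_le hπβ hω
  set D : ℂ := -Complex.I * (ω : ℂ) + ((-2 * ∑ i, Real.cos (p i) - μ : ℝ) : ℂ) with hD
  have hDim : D.im = -ω := by simp [hD]
  have hDnorm : |ω| ≤ ‖D‖ := by
    calc |ω| = |D.im| := by rw [hDim, abs_neg]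
      _ ≤ ‖D‖ := Complex.abs_im_le_norm D
  have hDne : D ≠ 0 := fun h => by
    rw [h, norm_zero] at hDnorm
    linarith
  have hnum : (-Complex.I * (ω : ℂ) + ((-2 * ∑ i, Real.cos (p i) - μ - K.eval p : ℝ) : ℂ)) = D - (K.eval p : ℂ) := by
    rw [hD]; push_cast; ring
  rw [hnum, sub_div, div_self hDne]
  have hK := TrigPolyC4v.abs_eval_le_coeffNorm K p
  calc ‖(1 : ℂ) - (K.eval p : ℂ) / D‖ ≤ ‖(1 : ℂ)‖ + ‖(K.eval p : ℂ) / D‖ := norm_sub_le _ _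
    _ = 1 + |K.eval p| / ‖D‖ := by rw [norm_one, norm_div, Complex.norm_real, Real.norm_eq_abs]
    _ ≤ 1 + K.coeffNorm 0 * (β / Real.pi) := by
      gcongr 1 + ?_
      rw [div_le_iff₀ (lt_of_lt_of_le hω0 hDnorm)]
      calc |K.eval p| ≤ K.coeffNorm 0 * 1 := by rw [mul_one]; exact hK
        _ = K.coeffNorm 0 * (β / Real.pi) * (Real.pi / β) := by field_simp
        _ ≤ K.coeffNorm 0 * (β / Real.pi) * ‖D‖ :=
          mul_le_mul_of_nonneg_left (hω.trans hDnorm)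
            (by have := TrigPolyC4v.coeffNorm_nonneg 0 K; positivity)

omit [NeZero L] in
/-- The dressing at the grid point: `ĝ₀/ĝ_K` read through the band `bandCT`. -/
theorem propCT_zero_div_propCT_eq_band {β : ℝ} (hβ : β ≠ 0) (μ : ℝ) (K : TrigPolyC4v) (ω : MatsubaraIdx M) (k : TorusSite 2 L) :
    propCT L M β μ 0 (ω, k) / propCT L M β μ K (ω, k) =
      (-Complex.I * (matsubaraFreq β M ω : ℂ) +
          ((-2 * ∑ i, Real.cos (latticeMomentum L k i) - μ - K.eval (latticeMomentum L k) : ℝ) : ℂ)) /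
        (-Complex.I * (matsubaraFreq β M ω : ℂ) + ((-2 * ∑ i, Real.cos (latticeMomentum L k i) - μ : ℝ) : ℂ)) := by
  rw [propCT_zero_div_propCT hβ]
  have e1 : (nambuXiCT L μ K k : ℝ) = -2 * ∑ i, Real.cos (latticeMomentum L k i) - μ - K.eval (latticeMomentum L k) := by
    rw [nambuXiCT, torusBand]
  have e0 : (nambuXiCT L μ 0 k : ℝ) = -2 * ∑ i, Real.cos (latticeMomentum L k i) - μ := by
    rw [nambuXiCT_zero_frame, nambuXi, torusBand]
  simp only [e1, e0]

/-! ## §3 The tadpole average is `−reprFree` at the bare frame and coincident points -/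

omit [NeZero L] in
/-- `e^{ip·(x̄ − x̄)} = 1`. -/
theorem sitePhase_self (k xe : TorusSite 2 L) : sitePhase L k xe xe = 1 := by
  simp [sitePhase]

/-- `(βL²)⁻¹ Σ_q ĝ₀(q) = −reprFree(K = 0, σ = σ', x̄ = ȳ)`. -/
theorem tadpoleAvg_eq_neg_reprFree (β μ : ℝ) (σ : Fin 2) (xe : TorusSite 2 L) :
    (∑ q : FreqMomentum L M, propCT L M β μ 0 q) / ((β * (L : ℝ) ^ 2 : ℝ) : ℂ) = -reprFree L M β μ 0 σ σ xe xe := by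
  rw [reprFree, if_pos rfl, neg_div, neg_neg]
  congr 1
  exact Finset.sum_congr rfl fun q _ => by rw [sitePhase_self, one_mul]

/-! ## §4 The order-`U¹` rung satisfies the volume-limit text -/

/-- **THE ORDER-`U¹` RUNG OF CHILD 5 IS WITNESS-PRESENT**: the first `U`-derivative of the VL carrier,
`S₁(L,M;k,σ) = d/dU|₀ klSelfEnergy L M β U μ K klE0 (nScales β + 1) k σ`, satisfies the three clauses of `FinalTwoLegVolLimit` verbatim —
a momentum-continuous limit per Matsubara integer, a volume-uniform bound `½(1 + ‖K‖₀β/π)²`, and grid convergence eventually in `L` then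
in `M` (`β > 0`, every `μ`, `K`, `Mstar`). -/
theorem firstOrder_volLimit {β : ℝ} (hβ : 0 < β) (μ : ℝ) (K : TrigPolyC4v) (Mstar : ℕ → ℕ) :
    ∃ sigmaInf : ℤ → (Fin 2 → ℝ) → Fin 2 → ℂ, ∃ B : ℝ, ∃ L₀ : ℕ,
      (∀ (n : ℤ) (σ : Fin 2), Continuous fun p : Fin 2 → ℝ => sigmaInf n p σ) ∧
      (∀ (L : ℕ) [NeZero L], L₀ ≤ L → ∀ (M : ℕ) [NeZero M], Mstar L ≤ M →
        ∀ (k : FreqMomentum L M) (σ : Fin 2),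
          ‖deriv (fun U : ℝ => klSelfEnergy L M β U μ K klE0 (nScales β + 1) k σ) 0‖ ≤ B) ∧
      (∀ (n : ℤ) (σ : Fin 2) (ε : ℝ), 0 < ε → ∃ L₁ : ℕ, ∀ (L : ℕ) [NeZero L], L₁ ≤ L →
        ∃ M₁ : ℕ, ∀ (M : ℕ) [NeZero M], M₁ ≤ M → ∀ ω : MatsubaraIdx M, matsubaraInt M ω = n →
          ∀ k : TorusSite 2 L,
            ‖deriv (fun U : ℝ => klSelfEnergy L M β U μ K klE0 (nScales β + 1) (ω, k) σ) 0 -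
                sigmaInf n (latticeMomentum L k) σ‖ ≤ ε) := by
  -- the iterated limit of the tadpole average, from child 4's free part at the bare frame and coincident points
  obtain ⟨fM, F, hM, hL⟩ := stub_asm_free β hβ μ 0 0 0 (0 : Site 2) (0 : Site 2)
  set ωn : ℤ → ℝ := fun n => Real.pi * (2 * (n : ℝ) + 1) / β with hωn
  set dress : ℤ → (Fin 2 → ℝ) → ℂ := fun n p =>
    (-Complex.I * (ωn n : ℂ) + ((-2 * ∑ i, Real.cos (p i) - μ - K.eval p : ℝ) : ℂ)) /
      (-Complex.I * (ωn n : ℂ) + ((-2 * ∑ i, Real.cos (p i) - μ : ℝ) : ℂ)) with hdress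
  set Bd : ℝ := 1 + K.coeffNorm 0 * (β / Real.pi) with hBd
  have hBd0 : 0 ≤ Bd := by
    have := TrigPolyC4v.coeffNorm_nonneg 0 K
    positivity
  have hωn_abs : ∀ n : ℤ, Real.pi / β ≤ |ωn n| := fun n => by
    rw [hωn]; dsimp only
    rw [abs_div, abs_of_pos hβ, abs_mul, abs_of_pos Real.pi_pos]
    exact div_le_div_of_nonneg_right (le_mul_of_one_le_right Real.pi_pos.le (one_le_abs_two_mul_add_one n)) hβ.le
  -- the explicit derivative
  have hderiv : ∀ (L : ℕ) [NeZero L] (M : ℕ) (k : FreqMomentum L M) (σ : Fin 2),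
      deriv (fun U : ℝ => klSelfEnergy L M β U μ K klE0 (nScales β + 1) k σ) 0 =
        -(propCT L M β μ 0 k / propCT L M β μ K k) ^ 2 *
          ((∑ q : FreqMomentum L M, propCT L M β μ 0 q) / ((β * (L : ℝ) ^ 2 : ℝ) : ℂ)) :=
    fun L _ M k σ => (hasDerivAt_klSelfEnergy_nScales_succ_zero_hartree hβ μ K k σ).deriv
  refine ⟨fun n p _ => -(dress n p) ^ 2 * (-F), 1 / 2 * Bd ^ 2, 0, ?_, ?_, ?_⟩
  · -- continuity
    intro n σ
    have hden : ∀ p : Fin 2 → ℝ, -Complex.I * (ωn n : ℂ) + ((-2 * ∑ i, Real.cos (p i) - μ : ℝ) : ℂ) ≠ 0 := by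
      intro p h
      have := congrArg Complex.im h
      simp at this
      have h' := hωn_abs n
      have hπβ : 0 < Real.pi / β := div_pos Real.pi_pos hβ
      rw [this, abs_zero] at h'
      linarith
    have hcos : Continuous fun p : Fin 2 → ℝ => -2 * ∑ i, Real.cos (p i) - μ :=
      ((continuous_const.mul (continuous_finsetSum _ fun i _ =>
        Real.continuous_cos.comp (continuous_apply i))).sub continuous_const)
    have hK : Continuous fun p : Fin 2 → ℝ => K.eval p := TrigPolyC4v.continuous_eval K
    have hd : Continuous (dress n) := by
      refine Continuous.div ?_ ?_ hden
      · exact continuous_const.add (Complex.continuous_ofReal.comp (hcos.sub hK))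
      · exact continuous_const.add (Complex.continuous_ofReal.comp hcos)
    exact (hd.pow 2).neg.mul continuous_const
  · -- uniform bound
    intro L _ _ M _ _ k σ
    rw [hderiv, norm_mul, norm_neg, norm_pow]
    have h1 : ‖propCT L M β μ 0 k / propCT L M β μ K k‖ ≤ Bd := by
      obtain ⟨ω, kv⟩ := k
      rw [propCT_zero_div_propCT_eq_band hβ.ne']
      exact norm_dressing_le hβ μ K _ (pi_div_le_abs_matsubaraFreq hβ ω) _
    have h2 := norm_tadpoleAvg_le (L := L) (M := M) hβ μ
    calc ‖propCT L M β μ 0 k / propCT L M β μ K k‖ ^ 2 *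
          ‖(∑ q : FreqMomentum L M, propCT L M β μ 0 q) / ((β * (L : ℝ) ^ 2 : ℝ) : ℂ)‖
        ≤ Bd ^ 2 * (1 / 2) := by
          gcongr
      _ = 1 / 2 * Bd ^ 2 := by ring
  · -- grid convergence
    intro n σ ε hε
    have hε' : 0 < ε / (Bd ^ 2 + 1) := by positivity
    -- `L`-threshold from `fM → F`, then `M`-threshold from `reprFree → fM L`
    obtain ⟨L₁, hL₁⟩ := Metric.tendsto_atTop.1 hL (ε / (Bd ^ 2 + 1) / 2) (half_pos hε')
    refine ⟨max L₁ 3, fun L _ hLge => ?_⟩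
    have hL3 : 3 ≤ L := le_trans (le_max_right _ _) hLge
    have hLL : L₁ ≤ L := le_trans (le_max_left _ _) hLge
    obtain ⟨M₁, hM₁⟩ := Metric.tendsto_atTop.1 (hM L hL3) (ε / (Bd ^ 2 + 1) / 2) (half_pos hε')
    refine ⟨M₁, fun M _ hMge ω hω k => ?_⟩
    rw [hderiv]
    -- the dressing on the grid IS `dress n (p_k)`
    have hdr : propCT L M β μ 0 (ω, k) / propCT L M β μ K (ω, k) = dress n (latticeMomentum L k) := by
      rw [propCT_zero_div_propCT_eq_band hβ.ne', matsubaraFreq_of_matsubaraInt_eq β hω]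
    -- the tadpole average versus its limit
    have hA : (∑ q : FreqMomentum L M, propCT L M β μ 0 q) / ((β * (L : ℝ) ^ 2 : ℝ) : ℂ) =
        -reprFree L M β μ 0 0 0 (Torus.proj L (0 : Site 2)) (Torus.proj L (0 : Site 2)) :=
      tadpoleAvg_eq_neg_reprFree β μ 0 _
    have hclose : ‖reprFree L M β μ 0 0 0 (Torus.proj L (0 : Site 2)) (Torus.proj L (0 : Site 2)) - F‖ ≤ ε / (Bd ^ 2 + 1) := by
      have h1 := hM₁ M hMge
      have h2 := hL₁ L hLL
      rw [dist_eq_norm] at h1 h2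
      calc ‖reprFree L M β μ 0 0 0 (Torus.proj L 0) (Torus.proj L 0) - F‖
          ≤ ‖reprFree L M β μ 0 0 0 (Torus.proj L 0) (Torus.proj L 0) - fM L‖ + ‖fM L - F‖ := norm_sub_le_norm_sub_add_norm_sub _ _ _
        _ ≤ ε / (Bd ^ 2 + 1) / 2 + ε / (Bd ^ 2 + 1) / 2 := add_le_add h1.le h2.le
        _ = ε / (Bd ^ 2 + 1) := by ring
    have hdb : ‖dress n (latticeMomentum L k)‖ ≤ Bd := by
      rw [hdress]
      exact norm_dressing_le hβ μ K _ (hωn_abs n) _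
    rw [hdr, hA]
    calc ‖-(dress n (latticeMomentum L k)) ^ 2 * -reprFree L M β μ 0 0 0 (Torus.proj L 0) (Torus.proj L 0) -
            -(dress n (latticeMomentum L k)) ^ 2 * -F‖
        = ‖dress n (latticeMomentum L k)‖ ^ 2 * ‖reprFree L M β μ 0 0 0 (Torus.proj L 0) (Torus.proj L 0) - F‖ := by
          rw [← mul_sub, norm_mul, norm_neg, norm_pow, ← neg_sub, norm_neg, neg_sub_neg, ← neg_sub, norm_neg]
      _ ≤ Bd ^ 2 * (ε / (Bd ^ 2 + 1)) := by gcongr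
      _ ≤ ε := by
          rw [← mul_div_assoc, div_le_iff₀ (by positivity)]
          nlinarith [sq_nonneg Bd]

end Summit.HubbardSuperconductivity.HubbardSuperconductivity.Theorems.TwoPointAssembly

end
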